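import Literature.AlgebraicGeometry.CossartPiltant200819.Thm21FromPrintedLeaves2008
import Literature.AlgebraicGeometry.CossartPiltant200819.StableModelCriterion2008
import Mathlib.NumberTheory.Cyclotomic.Basic
import Mathlib.RingTheory.Polynomial.Cyclotomic.Roots
import HarnessLib

/-!
# Cossart–Piltant 2008, Lemma 9.4: the reduction to `μ_l ⊂ K` (HAL p. 29, l. 3–13), proved

V. Cossart, O. Piltant, *Resolution of singularities of threefolds in positive characteristic.
I*, J. Algebra 320 (2008) 1051–1082 [CossartPiltant2008]; authors' manuscript HAL hal-00139124
(held text `paper:doi-10-1016-j-jalgebra-2008-03-032`).  LOCATORS: "HAL p. N" is the PRINTED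
page number of the manuscript (page file `p00(N+1).txt` of the held text); the statement of
Lemma 9.4 (= journal Lemma 9.2) is the last six lines of HAL p. 28 and its proof is HAL p. 29,
l. 3–65 (the older modules `Ramification2008`, `TameDescent2008`, `StableModelCriterion2008` cite
the same lines as "HAL p. 30, l. 3–65", counting PDF pages).

The directory types the printed proof of Lemma 9.4 as: Prop. 9.3 for the cases `f = l`, `g = l`
(`descent_of_inertiaGroup_ne_top`, PROVED from `DescentBelowInertiaField`), the stability
statement (S3\*) used without proof at l. 14–16 (`GStableUniformizationAbove`, hypothesis), and
the leaf `TamePrimeDescentViaStableModel` = "what l. 16–65 establish".  That leaf is quantified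
over EVERY `(K, L, W)` of the lemma, whereas the printed l. 14–65 run under the two standing
reductions made at l. 3–13, VERBATIM (HAL p. 29):

> "Proof. We have `L = Kⁱ(W/V)` -in which case the lemma follows from proposition 9.3 (Galois
> case)- except if `s = f = p^d = 1`, `e = l` in (9), which we assume from now on. In particular
> `G := Gal(L/K) = G_i(W/V) = ℤ/l` and `G_r(W/V) = (1)`. Let `μ_l` be the group of `l`th-roots
> of unity in `k` [read `k̄`: the held text drops overlines, and `μ_l ⊄ K ⊇ k` is contemplated
> next] and `ζ_l` be a generator of `μ_l`. First assume that `μ_l ⊄ K`. Let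
> `K' := K(ζ_l)` and `L' := L(ζ_l)`. Then `L'/K'` is still a Galois extension with group `G`,
> where `G` acts trivially on `μ_l`. Let `W'` be an extension of `W` to `L'` and `V' := W' ∩ K'`.
> By (8), `μ_l ⊆ κ(W) = κ(V)`, so that we have `G_i(W'/W) = G_i(V'/V) = (1)`, i.e. `V` (resp.
> `W`) totally splits in `K'` (resp. `L'`). By corollary 6.3, `W'/k` has a local uniformization
> since `W` has. If `V'/k` has local uniformization, then `V` has local uniformization too by
> proposition 9.3 (Galois case). In other terms, it can be assumed that `μ_l ⊂ K`."

This module PROVES that reduction and re-threads the directory's dependency statements through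
the correspondingly sharper leaf:

* `TamePrimeDescentRoots` — Lemma 9.4 with the extra hypothesis "`μ_l ⊂ K`" (`K` contains a
  primitive `l`-th root of unity, `l = [L : K]`); `tamePrimeDescent_of_roots` — PROVED:
  Cor. 6.3 (`ClimbToInertiaField`) and Prop. 9.3 (`DescentBelowInertiaField`) reduce Lemma 9.4
  to it, exactly along l. 6–13: `L' := L(ζ_l)` (Mathlib's `CyclotomicField l L`), `K' := K(ζ_l)
  ⊆ L'`, `W'` an extension of `W` (Chevalley); `[L' : K'] = l` and `L'/K'` Galois
  (`finrank_adjoin_primitiveRoot_eq`, `isGalois_cyclotomicField_of_isGalois` — the printed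
  "`L'/K'` is still a Galois extension with group `G`"); `W'` is uniformizable by Cor. 6.3 in
  `L'/L` and `V` by Prop. 9.3 in `L'/K` from `V'`.  The membership of `K'` (resp. `L'`) in the
  inertia field of `W'` over `V` (resp. over `W`) — the printed "`G` acts trivially on `μ_l`",
  "`G_i(W'/W) = (1)`" — is derived here NOT from (8) (HAL p. 6, `G_i/G_r ≃ Hom(W_L/V_K, κ(W)^×)`)
  but from the elementary `valuation_sub_one_eq_one_of_pow_eq_one`: two distinct `l`-th roots
  of unity are distinct modulo `m_{W'}` because `l` is a unit of `W'`, so an element of an inertia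
  group fixes `μ_l` (`apply_eq_of_mem_inertiaGroup_of_pow_eq_one`).  The printed clause "`V`
  (resp. `W`) totally splits in `K'` (resp. `L'`)" is not typed and not used.
* `TamePrimeDescentViaStableModelRoots` — the leaf "what HAL p. 29, l. 14–65 establish" WITH its
  two standing hypotheses `G = G_i(W/V)` (every element of `Gal(L/K)` is inertial at `W`, l. 5)
  and `μ_l ⊂ K` (l. 13); `TamePrimeDescentViaStableModel.roots` — the directory's leaf implies
  it (trivially); `tamePrimeDescentRoots_of_viaStableModelRoots_of_inertia` — with (S3\*) for
  inertial `W` (`GStableUniformizationInertial`) and Prop. 9.3 it gives `TamePrimeDescentRoots`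
  (the case split of l. 3–5, as in `tamePrimeDescent_of_viaStableModel_of_inertia`).
* the dependency statements of `TamePrimeDescentAssembly2008`, `ArcDescent2008`,
  `ArcDescentCore2008` and `Thm21FromPrintedLeaves2008` re-threaded through the sharper leaf
  (suffix `_roots`; Cor. 6.3 is supplied by `climbToInertiaField_of_principalization` where
  [CP-2019] Prop. 4.4 is a hypothesis, and is an extra hypothesis `h63` otherwise).

Nothing here asserts Lemma 9.4, (S3\*) or any leaf; the sharper leaf is WEAKER than
`TamePrimeDescentViaStableModel`, so every `_roots` statement is implied by (and sharper than)
its namesake.  Cell record: pub-hironaka OBS-cp1-g14-1 (edge (α) of gen 14).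

## References

* [CossartPiltant2008] Lemma 9.4 and its proof, HAL pp. 28–29; Cor. 6.3 (HAL p. 20); Prop. 9.3
  (HAL p. 27); §3.2 (8) (HAL p. 6).
-/

namespace Literature.AlgebraicGeometry.CossartPiltant200819.CP2008

open Literature.AlgebraicGeometry.Resolution Polynomial IntermediateField
open scoped IntermediateField Pointwise

universe u

/-! ### Roots of unity of order a unit of the valuation ring -/

section RootsOfUnity

variable {M : Type u} [Field M] (U : ValuationSubring M)

/-- A root of unity is a unit of every valuation ring (standard valuation theory, recorded as
the ground of HAL p. 29, l. 8–10). [cite: CossartPiltant2008, Lemma 9.4 proof (HAL p. 29, l. 8–10)] -/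
theorem valuation_eq_one_of_pow_eq_one {η : M} {n : ℕ} (hn : n ≠ 0) (hη : η ^ n = 1) :
    U.valuation η = 1 := by
  rcases lt_trichotomy (U.valuation η) 1 with h | h | h
  · exfalso
    have h1 : U.valuation (η ^ n) < 1 := by
      rw [map_pow]
      exact pow_lt_one₀ zero_le h hn
    rw [hη, map_one] at h1
    exact lt_irrefl _ h1
  · exact h
  · exfalso
    have h1 : 1 < U.valuation (η ^ n) := by
      rw [map_pow]
      exact one_lt_pow₀ h hn
    rw [hη, map_one] at h1
    exact lt_irrefl _ h1

/-- **Distinct roots of unity of order a unit stay distinct in the residue field**: if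
`η ^ n = 1`, `η ≠ 1` and `n` is a unit of the valuation ring `U`, then `U(η - 1) = 1`.  (If
`U(η - 1) < 1` then every `U(η^i - 1) < 1`, and `n = Σ_{i<n} (1 - η^i)` — the geometric sum
`Σ η^i` vanishes — would have value `< 1`.)  Standard valuation theory: the elementary fact
behind "`G` acts trivially on `μ_l`" and "`G_i(W'/W) = G_i(V'/V) = (1)`" at HAL p. 29, l. 8–10
(there deduced from (8)). [cite: CossartPiltant2008, Lemma 9.4 proof (HAL p. 29, l. 8–10)] -/
theorem valuation_sub_one_eq_one_of_pow_eq_one {η : M} {n : ℕ} (hη : η ^ n = 1)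
    (hη1 : η ≠ 1) (hn : U.valuation (n : M) = 1) : U.valuation (η - 1) = 1 := by
  have hn0 : n ≠ 0 := by
    rintro rfl
    rw [Nat.cast_zero, map_zero] at hn
    exact zero_ne_one hn
  have hvη : U.valuation η = 1 := valuation_eq_one_of_pow_eq_one U hn0 hη
  have hle : U.valuation (η - 1) ≤ 1 := U.valuation.map_sub_le hvη.le (by rw [map_one])
  refine le_antisymm hle (not_lt.mp fun hlt => ?_)
  -- every `η ^ i - 1` then has value `< 1`
  have hpow : ∀ i : ℕ, U.valuation (η ^ i - 1) < 1 := fun i => by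
    rw [← geom_sum_mul η i, map_mul]
    have hS : U.valuation (∑ j ∈ Finset.range i, η ^ j) ≤ 1 :=
      U.valuation.map_sum_le fun j _ => by rw [map_pow, hvη, one_pow]
    calc U.valuation (∑ j ∈ Finset.range i, η ^ j) * U.valuation (η - 1)
        ≤ 1 * U.valuation (η - 1) := mul_le_mul' hS le_rfl
      _ < 1 := by rw [one_mul]; exact hlt
  -- the geometric sum `1 + η + ⋯ + η^{n-1}` vanishes (`η ≠ 1`, `η ^ n = 1`)
  have hsum : ∑ j ∈ Finset.range n, η ^ j = 0 := by
    have h := geom_sum_mul η n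
    rw [hη, sub_self] at h
    exact (mul_eq_zero.mp h).resolve_right (sub_ne_zero.mpr hη1)
  -- hence `n = Σ_{j<n} (1 - η^j)` has value `< 1`
  have hn' : (n : M) = ∑ j ∈ Finset.range n, (1 - η ^ j) := by
    rw [Finset.sum_sub_distrib, hsum, sub_zero, Finset.sum_const, Finset.card_range,
      nsmul_eq_mul, mul_one]
  have hlt' : U.valuation (n : M) < 1 := by
    rw [hn']
    refine U.valuation.map_sum_lt one_ne_zero fun j _ => ?_
    rw [← neg_sub, Valuation.map_neg]
    exact hpow j
  rw [hn] at hlt'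
  exact lt_irrefl _ hlt'

/-- `n` is a unit of a valuation ring containing a field `k` in which `n ≠ 0` (here: `l ≠ p`,
so `l` is a unit of `W'`; ground of HAL p. 29, l. 9). [cite: CossartPiltant2008, Lemma 9.4 proof (HAL p. 29, l. 9)] -/
theorem valuation_natCast_eq_one_of_ne_zero {k : Type u} [Field k] [Algebra k M]
    (hk : ∀ c : k, algebraMap k M c ∈ U) {n : ℕ} (hn : (n : k) ≠ 0) :
    U.valuation (n : M) = 1 := by
  have h := valuation_eq_one_of_mem_of_inv_mem U (x := algebraMap k M n)
    ((_root_.map_ne_zero _).mpr hn) (hk _) (by rw [← map_inv₀]; exact hk _)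
  rwa [map_natCast] at h

variable {K : Type u} [Field K] [Algebra K M]

/-- **An element of the inertia group `G_i` fixes every root of unity whose order is a unit of
the valuation ring** (HAL p. 29, l. 8: "`G` acts trivially on `μ_l`"): for `σ ∈ G_i(U/U ∩ K)`,
`η ^ n = 1` and `U(n) = 1`, `σ η = η` — otherwise `θ := σ(η)/η ≠ 1` is an `n`-th root of unity,
`U(θ - 1) = 1` (`valuation_sub_one_eq_one_of_pow_eq_one`), contradicting `U(σ η - η) < 1`.
[cite: CossartPiltant2008, Lemma 9.4 proof (HAL p. 29, l. 8)] -/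
theorem apply_eq_of_mem_inertiaGroup_of_pow_eq_one {σ : M ≃ₐ[K] M}
    (hσ : σ ∈ inertiaGroup (K := K) U) {η : M} {n : ℕ} (hη : η ^ n = 1)
    (hn : U.valuation (n : M) = 1) : σ η = η := by
  obtain ⟨-, hresid⟩ := (mem_inertiaGroup_iff' U σ).mp hσ
  have hn0 : n ≠ 0 := by
    rintro rfl
    rw [Nat.cast_zero, map_zero] at hn
    exact zero_ne_one hn
  have hη0 : η ≠ 0 := by
    rintro rfl
    rw [zero_pow hn0] at hη
    exact zero_ne_one hη
  have hvη : U.valuation η = 1 := valuation_eq_one_of_pow_eq_one U hn0 hη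
  have hlt : U.valuation (σ η - η) < 1 := hresid η ((U.valuation_le_one_iff η).mp hvη.le)
  by_contra hne
  -- `θ := σ η / η` is an `n`-th root of unity `≠ 1`, so `U(θ - 1) = 1`
  have hθ : (σ η * η⁻¹) ^ n = 1 := by
    rw [mul_pow, ← map_pow, hη, map_one, one_mul, inv_pow, hη, inv_one]
  have hθ1 : σ η * η⁻¹ ≠ 1 := fun h => hne ((mul_inv_eq_one₀ hη0).mp h)
  have h1 := valuation_sub_one_eq_one_of_pow_eq_one U hθ hθ1 hn
  have hfac : σ η - η = (σ η * η⁻¹ - 1) * η := by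
    rw [sub_mul, inv_mul_cancel_right₀ hη0, one_mul]
  rw [hfac, map_mul, h1, hvη, one_mul] at hlt
  exact lt_irrefl _ hlt

/-- **`K(ζ)` lies below the inertia field** of `U` over `U ∩ K`, for `ζ` a root of unity of
order a unit of `U` (HAL p. 29, l. 8 "`G` acts trivially on `μ_l`", used at l. 11–12 to apply
Cor. 6.3 and Prop. 9.3 to `K' = K(ζ_l)`). [cite: CossartPiltant2008, Lemma 9.4 proof (HAL p. 29, l. 8–12)] -/
theorem leInertiaField_adjoin_of_pow_eq_one {ζ : M} {n : ℕ} (hζ : ζ ^ n = 1)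
    (hn : U.valuation (n : M) = 1) : LeInertiaField K U K⟮ζ⟯ := by
  intro σ hσ x hx
  have hn0 : n ≠ 0 := by
    rintro rfl
    rw [Nat.cast_zero, map_zero] at hn
    exact zero_ne_one hn
  have hfix : σ ζ = ζ :=
    apply_eq_of_mem_inertiaGroup_of_pow_eq_one U ((mem_inertiaGroup_iff U σ).mpr hσ) hζ hn
  have hint : IsIntegral K ζ :=
    IsIntegral.of_pow (Nat.pos_of_ne_zero hn0) (by rw [hζ]; exact isIntegral_one)
  have hle : Algebra.adjoin K {ζ} ≤ AlgHom.equalizer (σ : M →ₐ[K] M) (AlgHom.id K M) :=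
    Algebra.adjoin_le (Set.singleton_subset_iff.mpr ((AlgHom.mem_equalizer _ _ ζ).mpr hfix))
  have hx' : x ∈ K⟮ζ⟯.toSubalgebra := hx
  rw [IntermediateField.adjoin_simple_toSubalgebra_of_isAlgebraic hint.isAlgebraic] at hx'
  exact (AlgHom.mem_equalizer _ _ x).mp (hle hx')

/-- **A cyclotomic extension `M = K(μ_n)`, `n` a unit of `U`, lies entirely below the inertia
field** of `U` over `U ∩ K`: its inertia group is trivial (HAL p. 29, l. 10: "`G_i(W'/W) = (1)`"
for `L' = L(ζ_l)` over `L`). [cite: CossartPiltant2008, Lemma 9.4 proof (HAL p. 29, l. 10)] -/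
theorem leInertiaField_top_of_isCyclotomicExtension {n : ℕ} [NeZero n]
    [IsCyclotomicExtension {n} K M] (hn : U.valuation (n : M) = 1) :
    LeInertiaField K U (⊤ : IntermediateField K M) := by
  intro σ hσ x _
  have h1 : σ = 1 :=
    IsCyclotomicExtension.algEquiv_eq_of_apply_eq (S := {n}) (A := K) (B := M) fun m hm _ => by
      rw [Set.mem_singleton_iff] at hm
      rw [hm]
      exact ⟨IsCyclotomicExtension.zeta n K M, IsCyclotomicExtension.zeta_spec n K M,
        apply_eq_of_mem_inertiaGroup_of_pow_eq_one U ((mem_inertiaGroup_iff U σ).mpr hσ)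
          (IsCyclotomicExtension.zeta_spec n K M).pow_eq_one hn⟩
  rw [h1]
  rfl

end RootsOfUnity

/-! ### `L(ζ_l)/K(ζ_l)` is Galois of degree `l` (HAL p. 29, l. 7–8) -/

section Cyclotomic

variable {K L : Type u} [Field K] [Field L] [Algebra K L]

/-- **`L(ζ_l)` is Galois over `K` when `L/K` is Galois** (`L ≠ K`): `L` is a splitting field
over `K` of some `p ≠ 0` and `L(ζ_l)` is the splitting field over `L` of `Φ_l`, so `L(ζ_l)` is
a splitting field of `p · Φ_l` over `K`; separability by transitivity (`l` a unit of `L`).  The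
printed "`L'/K'` is still a Galois extension" (HAL p. 29, l. 7) follows (`K ⊆ K' ⊆ L'`).
Standard field theory, recorded as the ground of that line.
[cite: CossartPiltant2008, Lemma 9.4 proof (HAL p. 29, l. 7)] -/
theorem isGalois_cyclotomicField_of_isGalois [FiniteDimensional K L] [IsGalois K L] (l : ℕ)
    [NeZero l] [NeZero ((l : ℕ) : L)] (hL : 1 < Module.finrank K L) :
    IsGalois K (CyclotomicField l L) := by
  obtain ⟨p, hp⟩ := Normal.exists_isSplittingField K L
  haveI := hp
  have hp0 : p ≠ 0 := by
    rintro rfl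
    have htop : (⊤ : Subalgebra K L) = ⊥ := by
      have h := hp.adjoin_rootSet
      rw [rootSet_zero, Algebra.adjoin_empty] at h
      exact h.symm
    have h1 : Module.finrank K L = 1 :=
      Subalgebra.bot_eq_top_iff_finrank_eq_one.mp htop.symm
    omega
  haveI : IsSplittingField L (CyclotomicField l L) ((cyclotomic l K).map (algebraMap K L)) := by
    rw [map_cyclotomic]
    exact IsCyclotomicExtension.splitting_field_cyclotomic l L (CyclotomicField l L)
  haveI : IsSplittingField K (CyclotomicField l L) (p * cyclotomic l K) :=
    IsSplittingField.mul (K := L) (CyclotomicField l L) p (cyclotomic l K) hp0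
      (cyclotomic_ne_zero l K)
  haveI : Normal K (CyclotomicField l L) := Normal.of_isSplittingField (p * cyclotomic l K)
  haveI : FiniteDimensional L (CyclotomicField l L) :=
    IsCyclotomicExtension.finiteDimensional {l} L (CyclotomicField l L)
  haveI : IsGalois L (CyclotomicField l L) := IsCyclotomicExtension.isGalois {l} L _
  haveI : Algebra.IsSeparable K (CyclotomicField l L) :=
    Algebra.IsSeparable.trans K L (CyclotomicField l L)
  exact ⟨⟩

/-- **`[L(ζ) : K(ζ)] = [L : K]` for `[L : K] = l` prime and `ζ` a primitive `l`-th root of unity**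
(HAL p. 29, l. 7–8: "`L'/K'` is still a Galois extension with group `G`"), for any field
`N = L(ζ) ⊇ L`: with `a := [K(ζ) : K]`, `b := [N : K(ζ)]`, `c := [N : L]`, the tower law gives
`a b = l c`; `a ≤ deg Φ_l = l - 1` (the minimal polynomial of `ζ` over `K` divides `Φ_l`) and
`c ≤ a` (the one over `L` divides the one over `K`), whence `l ∣ b ≤ l`.  Standard field
theory, recorded as the ground of that line. [cite: CossartPiltant2008, Lemma 9.4 proof (HAL p. 29, l. 7–8)] -/
theorem finrank_adjoin_primitiveRoot_eq {N : Type u} [Field N] [Algebra L N] [Algebra K N]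
    [IsScalarTower K L N] [FiniteDimensional K L] [FiniteDimensional L N] {l : ℕ} (hpr : l.Prime)
    (hKL : Module.finrank K L = l) {ζ : N} (hζ : IsPrimitiveRoot ζ l) (htop : L⟮ζ⟯ = ⊤) :
    Module.finrank K⟮ζ⟯ N = l := by
  haveI : FiniteDimensional K N := Module.Finite.trans L N
  haveI : NeZero l := ⟨hpr.ne_zero⟩
  have hint : IsIntegral K ζ := Algebra.IsIntegral.isIntegral ζ
  have hintL : IsIntegral L ζ := Algebra.IsIntegral.isIntegral ζ
  -- `a := [K(ζ) : K] < l`: the minimal polynomial of `ζ` divides `Φ_l`, of degree `l - 1`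
  have ha : Module.finrank K K⟮ζ⟯ < l := by
    rw [IntermediateField.adjoin.finrank hint]
    have hroot : Polynomial.aeval ζ (cyclotomic l K) = 0 := by
      rw [Polynomial.aeval_def, ← Polynomial.eval_map, map_cyclotomic]
      exact hζ.isRoot_cyclotomic hpr.pos
    have hle := Polynomial.natDegree_le_of_dvd (minpoly.dvd K ζ hroot) (cyclotomic_ne_zero l K)
    rw [natDegree_cyclotomic, Nat.totient_prime hpr] at hle
    have := hpr.one_lt
    omega
  -- `c := [N : L] ≤ a`: the minimal polynomial of `ζ` over `L` divides the one over `K`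
  have hc : Module.finrank L N ≤ Module.finrank K K⟮ζ⟯ := by
    have h1 : Module.finrank L N = Module.finrank L L⟮ζ⟯ := by
      rw [htop, IntermediateField.finrank_top']
    rw [h1, IntermediateField.adjoin.finrank hintL, IntermediateField.adjoin.finrank hint]
    have hne : (minpoly K ζ).map (algebraMap K L) ≠ 0 :=
      Polynomial.map_ne_zero (minpoly.ne_zero hint)
    calc (minpoly L ζ).natDegree ≤ ((minpoly K ζ).map (algebraMap K L)).natDegree :=
          Polynomial.natDegree_le_of_dvd (minpoly.dvd_map_of_isScalarTower K L ζ) hne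
      _ = (minpoly K ζ).natDegree :=
          Polynomial.natDegree_map_eq_of_injective (algebraMap K L).injective _
  -- the tower law `a · b = l · c`, `b := [N : K(ζ)]`
  have htower :
      Module.finrank K K⟮ζ⟯ * Module.finrank K⟮ζ⟯ N = l * Module.finrank L N := by
    rw [Module.finrank_mul_finrank K K⟮ζ⟯ N, ← hKL, Module.finrank_mul_finrank K L N]
  have ha0 : 0 < Module.finrank K K⟮ζ⟯ := Module.finrank_pos
  have hb0 : 0 < Module.finrank K⟮ζ⟯ N := Module.finrank_pos
  -- `l ∣ b` and `b ≤ l`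
  have hlb : l ∣ Module.finrank K⟮ζ⟯ N := by
    have h1 : l ∣ Module.finrank K K⟮ζ⟯ * Module.finrank K⟮ζ⟯ N := ⟨_, htower⟩
    exact ((Nat.Prime.dvd_mul hpr).mp h1).resolve_left (Nat.not_dvd_of_pos_of_lt ha0 ha)
  have hbl : Module.finrank K⟮ζ⟯ N ≤ l := by
    by_contra h
    have h' : l + 1 ≤ Module.finrank K⟮ζ⟯ N := Nat.succ_le_of_lt (not_le.mp h)
    have h2 : Module.finrank K K⟮ζ⟯ * (l + 1) ≤ l * Module.finrank K K⟮ζ⟯ :=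
      (Nat.mul_le_mul_left _ h').trans (htower ▸ Nat.mul_le_mul_left l hc)
    nlinarith
  exact le_antisymm hbl (Nat.le_of_dvd hb0 hlb)

/-- **Local uniformizability read back from the top intermediate field** `⊤ ≃ L` (transport
along `IntermediateField.topEquiv`; used to apply Cor. 6.3 with `K' = L'` at HAL p. 29, l. 11).
[cite: CossartPiltant2008, Lemma 9.4 proof (HAL p. 29, l. 11)] -/
theorem isLocallyUniformizable_of_top {k : Type u} [Field k] [Algebra k K] [Algebra k L]
    [IsScalarTower k K L] (W : ValuationSubring L)
    (h : IsLocallyUniformizable k (⊤ : IntermediateField K L)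
      (W.comap (algebraMap (⊤ : IntermediateField K L) L))) :
    IsLocallyUniformizable k L W := by
  haveI : IsScalarTower k (⊤ : IntermediateField K L) L :=
    isScalarTower_intermediateField' (k := k) ⊤
  let e : L ≃ₐ[k] (⊤ : IntermediateField K L) :=
    ((IntermediateField.topEquiv (F := K) (E := L)).restrictScalars k).symm
  have h' := isLocallyUniformizable_comap_algEquiv e _ h
  have hO : (W.comap (algebraMap (⊤ : IntermediateField K L) L)).comap
      (e : L →+* (⊤ : IntermediateField K L)) = W := by
    ext x
    simp only [ValuationSubring.mem_comap]
    have hx : algebraMap (⊤ : IntermediateField K L) L (e x) = x :=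
      (IntermediateField.topEquiv (F := K) (E := L)).apply_symm_apply x
    rw [RingHom.coe_coe, hx]
  rwa [hO] at h'

end Cyclotomic

/-! ### Lemma 9.4 with `μ_l ⊂ K`; the leaf of HAL p. 29 l. 14–65 with its standing hypotheses -/

/-- **Cossart–Piltant 2008, Lemma 9.4 under the reduction "`μ_l ⊂ K`"** (HAL p. 29, l. 13:
"In other terms, it can be assumed that `μ_l ⊂ K`"): the statement of Lemma 9.4
(`TamePrimeDescent`, HAL p. 28) with the extra hypothesis that `K` contains a primitive `l`-th
root of unity, `l = [L : K]`.  Hypothesis only; `tamePrimeDescent_of_roots` PROVES that it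
implies Lemma 9.4 given Cor. 6.3 and Prop. 9.3. [cite: CossartPiltant2008, Lemma 9.4 proof (HAL p. 29, l. 6–13)] -/
def TamePrimeDescentRoots : Prop :=
  ∀ (k K : Type u) [Field k] [Field K] [Algebra k K], (⊤ : IntermediateField k K).FG →
    Algebra.trdeg k K = 3 →
    ∀ (L : Type u) [Field L] [Algebra K L] [Algebra k L] [IsScalarTower k K L],
      FiniteDimensional K L → IsGalois K L →
      (Module.finrank K L).Prime → ((Module.finrank K L : ℕ) : K) ≠ 0 →
      (∃ ζ : K, IsPrimitiveRoot ζ (Module.finrank K L)) →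
      ∀ (W : ValuationSubring L) (hk : ∀ c : k, algebraMap k L c ∈ W),
        Nonempty W.valuation.RankOne → residueTrdeg k W hk = 0 →
          IsLocallyUniformizable k L W → IsLocallyUniformizable k K (W.comap (algebraMap K L))

/-- Lemma 9.4 implies its case `μ_l ⊂ K` (trivially). [cite: CossartPiltant2008, Lemma 9.4 (HAL pp. 28–29)] -/
theorem TamePrimeDescent.roots (h : TamePrimeDescent.{u}) : TamePrimeDescentRoots.{u} :=
  fun k K _ _ _ hfg htr L _ _ _ _ hfd hgal hpr hl _ W hk hrk hres hLU =>
    h k K hfg htr L hfd hgal hpr hl W hk hrk hres hLU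

/-- **What HAL p. 29, l. 14–65 of the proof of Lemma 9.4 establish, WITH the standing
hypotheses of those lines**: as `TamePrimeDescentViaStableModel` (`TameDescent2008.lean`: from
(S3\*) at every normal local model `R₀` of `V`, a local uniformization of `V`), but asked only
for `(K, L, W)` with `G = G_i(W/V)` (every `σ ∈ Gal(L/K)` inertial at `W`; l. 5 "In particular
`G := Gal(L/K) = G_i(W/V) = ℤ/l`") and `μ_l ⊂ K` (l. 13 "it can be assumed that `μ_l ⊂ K`").
These are the hypotheses under which the text diagonalises the action (`g.x_i = ζ_l^{t_i} x_i`
with `t_i ≢ 0 mod l` for some `i`, l. 17–21; cf. `Lemma94DiagonalCoordinates2008`).  Hypothesis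
only. [cite: CossartPiltant2008, Lemma 9.4 proof (HAL p. 29, l. 14–65)] -/
def TamePrimeDescentViaStableModelRoots : Prop :=
  ∀ (k K : Type u) [Field k] [Field K] [Algebra k K], (⊤ : IntermediateField k K).FG →
    Algebra.trdeg k K = 3 →
    ∀ (L : Type u) [Field L] [Algebra K L] [Algebra k L] [IsScalarTower k K L],
      FiniteDimensional K L → IsGalois K L →
      (Module.finrank K L).Prime → ((Module.finrank K L : ℕ) : K) ≠ 0 →
      (∃ ζ : K, IsPrimitiveRoot ζ (Module.finrank K L)) →
      ∀ (W : ValuationSubring L) (hk : ∀ c : k, algebraMap k L c ∈ W),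
        Nonempty W.valuation.RankOne → residueTrdeg k W hk = 0 →
          (∀ σ : L ≃ₐ[K] L, InInertiaGroup K W σ) →
          (∀ R₀ : Subalgebra k K, IsNormalLocalModelOf k K (W.comap (algebraMap K L)) R₀ →
            GStableUniformizationAbove (K := K) W R₀) →
          IsLocallyUniformizable k K (W.comap (algebraMap K L))

/-- The directory's leaf `TamePrimeDescentViaStableModel` implies the leaf with the standing
hypotheses (trivially: the two extra hypotheses are dropped).
[cite: CossartPiltant2008, Lemma 9.4 proof (HAL p. 29, l. 14–65)] -/
theorem TamePrimeDescentViaStableModel.roots (h : TamePrimeDescentViaStableModel.{u}) :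
    TamePrimeDescentViaStableModelRoots.{u} :=
  fun k K _ _ _ hfg htr L _ _ _ _ hfd hgal hpr hl _ W hk hrk hres _ hst =>
    h k K hfg htr L hfd hgal hpr hl W hk hrk hres hst

/-! ### The reduction of HAL p. 29, l. 6–13, proved -/

/-- **Cossart–Piltant 2008, Lemma 9.4: the reduction to `μ_l ⊂ K` (HAL p. 29, l. 6–13) —
PROVED from Cor. 6.3 (`ClimbToInertiaField`) and Prop. 9.3 (`DescentBelowInertiaField`).**
Given `(K, L, W)` as in Lemma 9.4 with `W` locally uniformizable: if `μ_l ⊂ K` the hypothesis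
applies; otherwise let `L' := L(ζ_l)` (`CyclotomicField l L`), `ζ := ζ_l ∈ L'`, `K' := K(ζ)
⊆ L'` and `W'` an extension of `W` to `L'` (Chevalley, `exists_valuationSubring_comap_eq`).
Then `L'/K` is Galois (`isGalois_cyclotomicField_of_isGalois`), hence so is `L'/K'`, and
`[L' : K'] = l` (`finrank_adjoin_primitiveRoot_eq`); `l` is a unit of `W'` (`l ≠ 0` in
`k ⊆ W'`), so every element of an inertia group at `W'` fixes `ζ` and `L' ⊆ Lⁱ(W'/W)`,
`K' ⊆ Kⁱ(W'/V)` (`leInertiaField_top_of_isCyclotomicExtension`,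
`leInertiaField_adjoin_of_pow_eq_one`).  (a) `W'` is locally uniformizable by Cor. 6.3 in
`L'/L` (l. 11); (b) `V' := W' ∩ K'` is, by the hypothesis at `(K', L', W')` (finite generation,
`trdeg 3`, rank one and residual algebraicity pass along the finite extensions,
`VState.Adm.up`/`.down`); (c) `V = W' ∩ K` is, by Prop. 9.3 in `L'/K` (l. 11–12).
[cite: CossartPiltant2008, Lemma 9.4 proof (HAL p. 29, l. 6–13), Cor 6.3 (HAL p. 20), Prop 9.3 (HAL p. 27)] -/
theorem tamePrimeDescent_of_roots (h63 : ClimbToInertiaField.{u})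
    (h93 : DescentBelowInertiaField.{u}) (h : TamePrimeDescentRoots.{u}) :
    TamePrimeDescent.{u} := by
  intro k K _ _ _ hfg htr L _ _ _ _ hfd hgal hpr hl W hk hrk hres hLU
  haveI := hfd
  haveI := hgal
  -- `μ_l ⊂ K`: the hypothesis applies
  by_cases hμ : ∃ ζ : K, IsPrimitiveRoot ζ (Module.finrank K L)
  · exact h k K hfg htr L hfd hgal hpr hl hμ W hk hrk hres hLU
  -- `l := [L : K]` is a unit of `k`, `K`, `L`
  set l : ℕ := Module.finrank K L with hl_def
  haveI : NeZero l := ⟨hpr.ne_zero⟩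
  haveI : NeZero ((l : ℕ) : K) := ⟨hl⟩
  haveI : NeZero ((l : ℕ) : L) := NeZero.nat_of_injective (algebraMap K L).injective
  have hlk : ((l : ℕ) : k) ≠ 0 := fun h0 =>
    hl (by rw [← map_natCast (algebraMap k K), h0, map_zero])
  -- `L' := L(ζ_l)`, `ζ := ζ_l`, `K' := K(ζ) ⊆ L'`
  let L' : Type u := CyclotomicField l L
  haveI : IsScalarTower k K L' := IsScalarTower.of_algebraMap_eq fun c => by
    rw [IsScalarTower.algebraMap_apply k L L', IsScalarTower.algebraMap_apply k K L,
      ← IsScalarTower.algebraMap_apply K L L']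
  haveI : FiniteDimensional L L' := IsCyclotomicExtension.finiteDimensional {l} L L'
  haveI : FiniteDimensional K L' := Module.Finite.trans L L'
  haveI : IsGalois L L' := IsCyclotomicExtension.isGalois {l} L L'
  haveI : IsGalois K L' := isGalois_cyclotomicField_of_isGalois l hpr.one_lt
  have hζ : IsPrimitiveRoot (IsCyclotomicExtension.zeta l L L') l :=
    IsCyclotomicExtension.zeta_spec l L L'
  set ζ : L' := IsCyclotomicExtension.zeta l L L' with hζ_def
  set K' : IntermediateField K L' := K⟮ζ⟯ with hK'_def
  haveI : IsScalarTower k K' L' := isScalarTower_intermediateField' (k := k) K'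
  -- `W'` an extension of `W` to `L'`; from now on `W = W' ∩ L`
  obtain ⟨W', hW'⟩ := exists_valuationSubring_comap_eq (Ω := L') W
  subst hW'
  have hkW' : ∀ c : k, algebraMap k L' c ∈ W' := fun c => by
    have h1 := hk c
    rwa [ValuationSubring.mem_comap, ← IsScalarTower.algebraMap_apply] at h1
  have hvl : W'.valuation ((l : ℕ) : L') = 1 := valuation_natCast_eq_one_of_ne_zero W' hkW' hlk
  -- bookkeeping: the standing hypotheses of the lemma at `(L', W')` and at `(K', W' ∩ K')`
  have hfgL : (⊤ : IntermediateField k L).FG := intermediateField_fg_top_of_finite hfg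
  have htrL : Algebra.trdeg k L = 3 := (trdeg_eq_of_isAlgebraic' (K := K) (L := L)).trans htr
  have hAdmL :
      VState.Adm ⟨L, W'.comap (algebraMap L L'), forall_algebraMap_mem_comap hkW'⟩ := by
    dsimp only [VState.Adm]
    exact ⟨hfgL, htrL, hrk, hres⟩
  have hAdmL' : VState.Adm ⟨L', W', hkW'⟩ := VState.Adm.up W' hkW' hAdmL
  have hAdmK' := hAdmL'.down (K := ↥K') W' hkW'
  dsimp only [VState.Adm] at hAdmL' hAdmK'
  obtain ⟨-, -, hrkW', hresW'⟩ := hAdmL'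
  obtain ⟨hfgK', htrK', -, -⟩ := hAdmK'
  -- (a) `W'` has a local uniformization: Cor. 6.3 in `L'/L`, where `L' ⊆ Lⁱ(W'/W)`
  have hLUW' : IsLocallyUniformizable k L' W' :=
    isLocallyUniformizable_of_top W'
      (h63 k L hfgL htrL L' inferInstance inferInstance W' hkW' ⊤
        (leInertiaField_top_of_isCyclotomicExtension W' hvl) hLU)
  -- (b) `V' := W' ∩ K'` has one: the hypothesis at `(K', L', W')`, where `μ_l ⊂ K' = K(ζ)`
  have hdeg : Module.finrank K' L' = l := by
    have htop : L⟮ζ⟯ = ⊤ := by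
      apply IntermediateField.toSubalgebra_injective
      rw [IntermediateField.adjoin_simple_toSubalgebra_of_isAlgebraic
          (Algebra.IsAlgebraic.isAlgebraic ζ), IntermediateField.top_toSubalgebra]
      exact IsCyclotomicExtension.adjoin_primitive_root_eq_top hζ
    exact finrank_adjoin_primitiveRoot_eq hpr rfl hζ htop
  have hprK' : (Module.finrank K' L').Prime := by rw [hdeg]; exact hpr
  haveI : NeZero ((l : ℕ) : K') := NeZero.nat_of_injective (algebraMap K K').injective
  have hlK' : ((Module.finrank K' L' : ℕ) : K') ≠ 0 := by rw [hdeg]; exact NeZero.ne _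
  have hζK' : ∃ ζ' : K', IsPrimitiveRoot ζ' (Module.finrank K' L') := by
    refine ⟨⟨ζ, IntermediateField.mem_adjoin_simple_self K ζ⟩, ?_⟩
    rw [hdeg]
    exact IsPrimitiveRoot.coe_submonoidClass_iff.mp hζ
  have hLUV' : IsLocallyUniformizable k K' (W'.comap (algebraMap K' L')) :=
    h k K' hfgK' htrK' L' inferInstance inferInstance hprK' hlK' hζK' W' hkW' hrkW' hresW' hLUW'
  -- (c) down to `V = W' ∩ K`: Prop. 9.3 in `L'/K`, where `K' = K(ζ) ⊆ Kⁱ(W'/V)`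
  obtain ⟨S₀, hS₀⟩ := exists_isLocalUniformizationOf _ hLUV'
  obtain ⟨-, -, -, R, hR, -⟩ :=
    h93 k K hfg htr L' inferInstance inferInstance W' hkW' hrkW' hresW' K'
      (leInertiaField_adjoin_of_pow_eq_one W' hζ.pow_eq_one hvl) S₀ hS₀
  rw [comap_comap_algebraMap L W']
  exact hR.isLocallyUniformizable _

/-- **The case split of HAL p. 29, l. 3–5 with the sharper leaf** (PROVED bookkeeping): Prop. 9.3
for `G_i(W/V) ≠ G` (`descent_of_inertiaGroup_ne_top`), the leaf
`TamePrimeDescentViaStableModelRoots` for `G_i(W/V) = G`, fed with (S3\*) for inertial `W`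
(`GStableUniformizationInertial`), give Lemma 9.4 under `μ_l ⊂ K`.
[cite: CossartPiltant2008, Lemma 9.4 proof (HAL p. 29, l. 3–5 and l. 14–16)] -/
theorem tamePrimeDescentRoots_of_viaStableModelRoots_of_inertia
    (h93 : DescentBelowInertiaField.{u}) (h₁ : TamePrimeDescentViaStableModelRoots.{u})
    (h₂ : GStableUniformizationInertial.{u}) : TamePrimeDescentRoots.{u} := by
  intro k K _ _ _ hfg htr L _ _ _ _ hfd hgal hpr hl hμ W hk hrk hres hLU
  haveI := hfd
  haveI := hgal
  by_cases htop : inertiaGroup (K := K) W = ⊤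
  · have hin : ∀ σ : L ≃ₐ[K] L, InInertiaGroup K W σ := fun σ =>
      (mem_inertiaGroup_iff W σ).mp (by rw [htop]; exact Subgroup.mem_top σ)
    exact h₁ k K hfg htr L hfd hgal hpr hl hμ W hk hrk hres hin
      (fun R₀ hR₀ => h₂ k K hfg htr L hfd hgal hpr hl W hk hrk hres hin hLU R₀ hR₀)
  · exact descent_of_inertiaGroup_ne_top h93 hfg htr hpr W hk hrk hres htop hLU

/-- **Lemma 9.4 from Cor. 6.3, Prop. 9.3, the leaf with its standing hypotheses and (S3\*) for
inertial `W`** (PROVED bookkeeping): `tamePrimeDescent_of_roots` with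
`tamePrimeDescentRoots_of_viaStableModelRoots_of_inertia`.  Compare
`StableModelCriterion2008.tamePrimeDescent_of_viaStableModel_of_inertia` (leaf
`TamePrimeDescentViaStableModel`, no Cor. 6.3). [cite: CossartPiltant2008, Lemma 9.4 (HAL pp. 28–29)] -/
theorem tamePrimeDescent_of_viaStableModelRoots_of_inertia (h63 : ClimbToInertiaField.{u})
    (h93 : DescentBelowInertiaField.{u}) (h₁ : TamePrimeDescentViaStableModelRoots.{u})
    (h₂ : GStableUniformizationInertial.{u}) : TamePrimeDescent.{u} :=
  tamePrimeDescent_of_roots h63 h93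
    (tamePrimeDescentRoots_of_viaStableModelRoots_of_inertia h93 h₁ h₂)

/-! ### The directory's dependency statements re-threaded through the sharper leaf -/

/-- **Lemma 9.4 over an arbitrary ground field from Cor. 6.3, Prop. 9.3, the sharper leaf,
Cor. 4.6, the transport and the rank-one residual** (PROVED bookkeeping; compare
`TamePrimeDescentAssembly2008.tamePrimeDescent_of_printed_leaves`).
[cite: CossartPiltant2008, Lemma 9.4 (HAL pp. 28–29)] -/
theorem tamePrimeDescent_of_printed_leaves_roots (h63 : ClimbToInertiaField.{u})
    (h93 : DescentBelowInertiaField.{u}) (h₁ : TamePrimeDescentViaStableModelRoots.{u})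
    (hcof : Cofinality.{u}) (hFu : PrimaryTransformRankOne.{u})
    (h1 : GStableUniformizationInertialRankOne.{u}) : TamePrimeDescent.{u} :=
  tamePrimeDescent_of_viaStableModelRoots_of_inertia h63 h93 h₁
    (gStableUniformizationInertial_of_printed_leaves hcof hFu h1)

/-- **The same with the rank-one residual split** by [BPR 2022, Prop. 2.3] and its two sub-cases
(PROVED bookkeeping; compare `ArcDescent2008.tamePrimeDescent_of_printed_leaves_cases`).
[cite: CossartPiltant2008, Lemma 9.4 (HAL pp. 28–29); BenitoPiltantReguera2022, Prop. 2.3 (HAL hal-01945228v1 p. 7)] -/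
theorem tamePrimeDescent_of_printed_leaves_cases_roots (h63 : ClimbToInertiaField.{u})
    (h93 : DescentBelowInertiaField.{u}) (h₁ : TamePrimeDescentViaStableModelRoots.{u})
    (hcof : Cofinality.{u}) (hFu : PrimaryTransformRankOne.{u})
    (hBPR : BenitoPiltantReguera2022QuadraticSequence.{u})
    (hnd : GStableUniformizationInertialRankOneNonDiscrete.{u})
    (hdi : GStableUniformizationInertialRankOneDiscreteImperfect.{u}) : TamePrimeDescent.{u} :=
  tamePrimeDescent_of_printed_leaves_roots h63 h93 h₁ hcof hFu
    (gStableUniformizationInertialRankOne_of_cases hBPR hnd hdi)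

/-- **HAL Lemma 9.4 from [CP-2019] Prop. 4.4, Prop. 9.3, the sharper leaf, [Fu1997] transported,
[BPR2022] Prop. 2.3 and the two residual sub-cases of (S3\*)** — Cor. 6.3 and Cor. 4.6 are
supplied by `climbToInertiaField_of_principalization` and `cofinality_of_principalization`
(compare `Thm21FromPrintedLeaves2008.tamePrimeDescent_of_principalization_of_cases`).
[cite: CossartPiltant2008, Lemma 9.4 (HAL pp. 28–29), Cor 4.6 (HAL p. 15), Cor 6.3 (HAL p. 20)] -/
theorem tamePrimeDescent_of_principalization_of_cases_roots
    (hP : CossartPiltant2019Principalization.{u}) (h93 : DescentBelowInertiaField.{u})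
    (h94r : TamePrimeDescentViaStableModelRoots.{u}) (hFu : PrimaryTransformRankOne.{u})
    (hBPR : BenitoPiltantReguera2022QuadraticSequence.{u})
    (hnd : GStableUniformizationInertialRankOneNonDiscrete.{u})
    (hdi : GStableUniformizationInertialRankOneDiscreteImperfect.{u}) : TamePrimeDescent.{u} :=
  tamePrimeDescent_of_printed_leaves_cases_roots (climbToInertiaField_of_principalization hP) h93
    h94r (cofinality_of_principalization hP) hFu hBPR hnd hdi

/-- **[CP-I] Thm. 2.1 VERBATIM for reduced quasi-projective threefolds — the dependency statement
of `Thm21FromPrintedLeaves2008.resolutionQuasiProjectiveThreefolds_of_printedLeaves_residuals`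
with the leaf of HAL p. 29 l. 14–65 asked only under its standing hypotheses**
(`TamePrimeDescentViaStableModelRoots` in place of `TamePrimeDescentViaStableModel`).
[cite: CossartPiltant2008, Thm 2.1 (HAL p. 3)] [cite: CossartPiltant2009, Theorem (p. 1839)]
[cite: CossartJannsenSaito2020, Introduction Thm. 1, Thm. 1.2] -/
theorem resolutionQuasiProjectiveThreefolds_of_printedLeaves_residuals_roots
    (h49 : RefinedPatchingQuasiProjective.{u}) (hP : CossartPiltant2019Principalization.{u})
    (h83 : PrimeDegreeAscent.{u}) (h93 : DescentBelowInertiaField.{u})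
    (h94r : TamePrimeDescentViaStableModelRoots.{u}) (hFu : PrimaryTransformRankOne.{u})
    (hBPR : BenitoPiltantReguera2022QuadraticSequence.{u})
    (hnd : GStableUniformizationInertialRankOneNonDiscrete.{u})
    (hdi : GStableUniformizationInertialRankOneDiscreteImperfect.{u})
    (cp2 : CossartPiltant2009Main.{u}) (hE : CossartJannsenSaito2020Embedded.{u})
    (h36 : CossartJannsenSaito2020Sequence.{u}) : ResolutionQuasiProjectiveThreefolds.{u} :=
  resolutionQuasiProjectiveThreefolds_of_leaves' h49 (rankReduction_of_cjs h36.general)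
    (climbToInertiaField_of_principalization hP) h83 h93
    (tamePrimeDescent_of_principalization_of_cases_roots hP h93 h94r hFu hBPR hnd hdi) cp2 hE h36

/-- **Both halves of the 2008 programme's top statement — the dependency statement of
`Thm21FromPrintedLeaves2008.cp2008_of_printedLeaves_residuals` through the sharper leaf.**
[cite: CossartPiltant2008, Thm 2.1 and Thm 7.2 (HAL pp. 3–4)] [cite: CossartPiltant2009, Theorem (p. 1839)]
[cite: CossartJannsenSaito2020, Thm. 1.2] -/
theorem cp2008_of_printedLeaves_residuals_roots (p49 : RefinedPatching.{u})
    (hP : CossartPiltant2019Principalization.{u}) (h83 : PrimeDegreeAscent.{u})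
    (h93 : DescentBelowInertiaField.{u}) (h94r : TamePrimeDescentViaStableModelRoots.{u})
    (hFu : PrimaryTransformRankOne.{u}) (hBPR : BenitoPiltantReguera2022QuadraticSequence.{u})
    (hnd : GStableUniformizationInertialRankOneNonDiscrete.{u})
    (hdi : GStableUniformizationInertialRankOneDiscreteImperfect.{u})
    (cp2 : CossartPiltant2009Main.{u}) (h36 : CossartJannsenSaito2020General.{u})
    (p41 : CossartJannsenSaito2020Embedded.{u}) :
    ResolutionAffineThreefolds.{u} ∧ LU3DiffFinite.{u} :=
  cp2008_of_leaves p49 (rankReduction_of_cjs h36) (climbToInertiaField_of_principalization hP)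
    h83 h93 (tamePrimeDescent_of_principalization_of_cases_roots hP h93 h94r hFu hBPR hnd hdi) cp2
    h36 p41

/-! ### Universe `0`: the core residual (Knaf–Kuhlmann 2009) with the sharper leaf -/

/-- **Lemma 9.4 under `μ_l ⊂ K` (universe `0`) from printed leaves, the transport,
Knaf–Kuhlmann 2009 Thm. 1.5 and the CORE rank-one residual** (PROVED bookkeeping; the proof of
`DiscreteDescent2008.tamePrimeDescent_of_printed_leaves_core` with the hypothesis `μ_l ⊂ K`
threaded to the sharper leaf). [cite: CossartPiltant2008, Lemma 9.4 (HAL pp. 28–29); KnafKuhlmann2009, Thm. 1.5] -/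
theorem tamePrimeDescentRoots_of_printed_leaves_core (h93 : DescentBelowInertiaField.{0})
    (h₁ : TamePrimeDescentViaStableModelRoots.{0}) (hcof : Cofinality.{0})
    (hFu : PrimaryTransformRankOne.{0}) (hKK : KnafKuhlmann2009MonogenicCompletion)
    (h1 : GStableUniformizationInertialRankOneCore) : TamePrimeDescentRoots.{0} := by
  intro k K _ _ _ hfg htr L _ _ _ _ hfd hgal hpr hl hμ W hk hrk hres hLU
  haveI := hfd
  haveI := hgal
  by_cases hdisc : IsDiscreteWithSeparableResidue k (W.comap (algebraMap K L))
  · exact descent_of_isDiscreteWithSeparableResidue hKK hfg W hk hdisc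
  by_cases htop : inertiaGroup (K := K) W = ⊤
  · have hin : ∀ σ : L ≃ₐ[K] L, InInertiaGroup K W σ := fun σ =>
      (mem_inertiaGroup_iff W σ).mp (by rw [htop]; exact Subgroup.mem_top σ)
    have hfix : ∀ σ : L ≃ₐ[K] L, σ • W = W := fun σ =>
      ((mem_inertiaGroup_iff' W σ).mp ((mem_inertiaGroup_iff W σ).mpr (hin σ))).1
    refine h₁ k K hfg htr L hfd hgal hpr hl hμ W hk hrk hres hin fun R₀ hR₀ => ?_
    rcases le_or_gt (2 : Cardinal) (ratRank W) with hrr | hrr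
    · exact gStableUniformizationAbove_of_printed_leaves_rankOne hcof hFu hfg htr W hk hrk hres
        hrr hfix hLU R₀ hR₀
    · exact h1 k K hfg htr L hfd hgal hpr hl W hk hrk hres hrr hin hLU hdisc R₀ hR₀
  · exact descent_of_inertiaGroup_ne_top h93 hfg htr hpr W hk hrk hres htop hLU

/-- **[CP-I] Thm. 2.1 VERBATIM (reduced quasi-projective threefolds), universe `0` — the
dependency statement of
`Thm21FromPrintedLeaves2008.resolutionQuasiProjectiveThreefolds_of_printedLeaves_residuals₀`
through the sharper leaf.** [cite: CossartPiltant2008, Thm 2.1 (HAL p. 3)] [cite: KnafKuhlmann2009, Thm. 1.5]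
[cite: CossartJannsenSaito2020, Introduction Thm. 1, Thm. 1.2] -/
theorem resolutionQuasiProjectiveThreefolds_of_printedLeaves_residuals₀_roots
    (h49 : RefinedPatchingQuasiProjective.{0}) (hP : CossartPiltant2019Principalization.{0})
    (h83 : PrimeDegreeAscent.{0}) (h93 : DescentBelowInertiaField.{0})
    (h94r : TamePrimeDescentViaStableModelRoots.{0}) (hFu : PrimaryTransformRankOne.{0})
    (hKK : KnafKuhlmann2009MonogenicCompletion)
    (hBPR : BenitoPiltantReguera2022QuadraticSequence.{0})
    (hnd : GStableUniformizationInertialRankOneNonDiscrete.{0})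
    (hdic : GStableUniformizationInertialRankOneDiscreteImperfectCore)
    (cp2 : CossartPiltant2009Main.{0}) (hE : CossartJannsenSaito2020Embedded.{0})
    (h36 : CossartJannsenSaito2020Sequence.{0}) : ResolutionQuasiProjectiveThreefolds.{0} :=
  resolutionQuasiProjectiveThreefolds_of_leaves' h49 (rankReduction_of_cjs h36.general)
    (climbToInertiaField_of_principalization hP) h83 h93
    (tamePrimeDescent_of_roots (climbToInertiaField_of_principalization hP) h93
      (tamePrimeDescentRoots_of_printed_leaves_core h93 h94r (cofinality_of_principalization hP)
        hFu hKK (gStableUniformizationInertialRankOneCore_of_cases hBPR hnd hdic)))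
    cp2 hE h36

end Literature.AlgebraicGeometry.CossartPiltant200819.CP2008
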